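import Literature.Topology.FourManifolds.FishtailParamsGlue
import Literature.Topology.FourManifolds.FishtailIota
import HarnessLib

/-!
# The concrete fishtail end data and its local hypotheses

Infrastructure for the explicit fishtail neighbourhood (R. Gompf, *More Cappell–Shaneson spheres
are standard*, Algebr. Geom. Topol. 10 (2010), proof of Thm 2.1 and Lemma 2.2; the named fact
`Literature.Topology.FourManifolds.gompf2010_framedTwist`). The concrete end data
`fishJ ε hε hε2 : IotaData` (the tube data `fishT` together with the model angle `θ₀ = 1`, the
clutching half-width `w = ρ_b/4`, the cut-off radii `ρ_b/2 < ρ_b` of the lift, the bend parameter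
`p₁ = 1/(50 c)`, the depth scale `E₁`, and the glue radii hole | corner | box
`r_h = ρ_b - δ_c - p₁ - E₁/c`, `r_c = ρ_b + 2δ_c`), and the verification of the local hypotheses
`IotaData.LocHyp δ_c` and `IotaData.ModelHyp`: hence the end map `ι` is a local diffeomorphism on
the model end (`IotaData.isLocalDiffeomorph_iotaO`).

Everything is proved; no named facts.

## References

* R. E. Gompf, *More Cappell–Shaneson spheres are standard*, Algebr. Geom. Topol. 10 (2010)
  1665–1681, proof of Thm 2.1 and Lemma 2.2. [GompfAGT2010]
-/

noncomputable section

open scoped Real Topology ContDiff Manifold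
open Set Filter

namespace Literature.Topology.FourManifolds

open FP in
/-- **The concrete fishtail end data.** [folklore] -/
def fishJ (ε : ℝ) (hε : 0 < ε) (hε2 : ε ≤ 1 / 2) : IotaData where
  toTubeDData := fishT ε hε hε2
  θ₀ := 1
  wS := rhoB ε hε hε2 / 4
  rΛ₁ := rhoB ε hε hε2 / 2
  rΛ₂ := rhoB ε hε hε2
  p₁ := p1 ε hε hε2
  E₁ := E1
  rh := rhoB ε hε hε2 - delC ε hε hε2 - p1 ε hε hε2 - E1 / cL ε hε hε2
  rc := rhoB ε hε hε2 + 2 * delC ε hε hε2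

namespace FP

variable {ε : ℝ} (hε : 0 < ε) (hε2 : ε ≤ 1 / 2)

/-- `tan (2π · 19/100) > 1`. [folklore] -/
theorem one_lt_tan_face : 1 < Real.tan (2 * π * (19 / 100)) := by
  rw [← Real.tan_pi_div_four]
  exact Real.tan_lt_tan_of_lt_of_lt_pi_div_two (by linarith [Real.pi_pos]) (by nlinarith [Real.pi_pos]) (by nlinarith [Real.pi_pos])

include hε2 in
/-- **The local hypotheses hold for the concrete end data**, with glue half-width `δ_c`. [folklore] -/
theorem locHyp : (fishJ ε hε hε2).LocHyp (delC ε hε hε2) := by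
  have hc := cL_pos ε hε hε2
  have hcρ := cL_mul_rhoB ε hε hε2
  have hρ0 := rhoB_pos hε hε2; have hρ := rhoB_le hε hε2
  have hE0 := E1_pos; have hE := E1_le
  have htan := tan_beta7_ge (ε := ε); have htan' := (tan_beta7_bounds ε).2
  have h7 := s7_gt ε hε
  have hη := eta_lt hε hε2; have hη0 := eta_pos ε hε
  obtain ⟨hs21, hs22⟩ := s2_bounds hε hε2
  obtain ⟨hq1, hq2⟩ := sqrt_three_bounds
  obtain ⟨hi1, hi2⟩ := inv_sqrt_three_bounds
  have hr0 : rzero ε = 12 + ε / 100 := by unfold rzero b2; ring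
  -- the small lengths `δ_c = 3/(100c)`, `p₁ = 1/(50c)`, `E₁/c`
  have hδ : cL ε hε hε2 * delC ε hε hε2 = 3 / 100 := by unfold delC; field_simp
  have hp : cL ε hε hε2 * p1 ε hε hε2 = 1 / 50 := by unfold p1; field_simp
  have hEc : cL ε hε hε2 * (E1 / cL ε hε hε2) = E1 := by field_simp
  have hδ0 : 0 < delC ε hε hε2 := by unfold delC; positivity
  have hp0 : 0 < p1 ε hε hε2 := by unfold p1; positivity
  have hEc0 : 0 < E1 / cL ε hε hε2 := by positivity
  -- `c (r_h - δ) = c ρ_b - 8/100 - E₁ ≥ s₇ + 0.0774`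
  have hkey : cL ε hε hε2 * (rhoB ε hε hε2 - delC ε hε hε2 - p1 ε hε hε2 - E1 / cL ε hε hε2 - delC ε hε hε2) = s7 ε + 22 / 100 + Real.tan (beta7 ε) - 8 / 100 - E1 := by
    have : cL ε hε hε2 * (rhoB ε hε hε2 - delC ε hε hε2 - p1 ε hε hε2 - E1 / cL ε hε hε2 - delC ε hε hε2) =
        cL ε hε hε2 * rhoB ε hε hε2 - 2 * (cL ε hε hε2 * delC ε hε hε2) - cL ε hε hε2 * p1 ε hε hε2 - cL ε hε hε2 * (E1 / cL ε hε hε2) := by ring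
    rw [this, hδ, hp, hEc, hcρ]; ring
  -- smallness of the lengths relative to `ρ_b` (`c ρ_b ≥ 30`)
  have hcρ30 : 30 ≤ cL ε hε hε2 * rhoB ε hε hε2 := by rw [hcρ]; linarith
  have hsmall : delC ε hε hε2 + p1 ε hε hε2 + E1 / cL ε hε hε2 + delC ε hε hε2 ≤ rhoB ε hε hε2 / 100 := by
    have h1 : cL ε hε hε2 * (delC ε hε hε2 + p1 ε hε hε2 + E1 / cL ε hε hε2 + delC ε hε hε2) = 8 / 100 + E1 := by
      rw [show cL ε hε hε2 * (delC ε hε hε2 + p1 ε hε hε2 + E1 / cL ε hε hε2 + delC ε hε hε2) =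
        2 * (cL ε hε hε2 * delC ε hε hε2) + cL ε hε hε2 * p1 ε hε hε2 + cL ε hε hε2 * (E1 / cL ε hε hε2) by ring, hδ, hp, hEc]; ring
    have h2 : cL ε hε hε2 * (delC ε hε hε2 + p1 ε hε hε2 + E1 / cL ε hε hε2 + delC ε hε hε2) ≤ cL ε hε hε2 * (rhoB ε hε hε2 / 100) := by
      rw [h1]; nlinarith
    exact le_of_mul_le_mul_left h2 hc
  refine
    { hE := hE0
      hE1 := by show E1 ≤ 1 / 2; linarith
      hc := hc
      hp₁ := hp0
      hw := by show 0 < rhoB ε hε hε2 / 4; positivity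
      hw1 := by show rhoB ε hε hε2 / 4 < rhoB ε hε hε2 / 2; linarith
      h12 := by show rhoB ε hε hε2 / 2 < rhoB ε hε hε2; linarith
      hyh := rfl
      hcδ := by
        show cL ε hε hε2 * (rhoB ε hε hε2 - (rhoB ε hε hε2 - delC ε hε hε2 - p1 ε hε hε2 - E1 / cL ε hε hε2) + delC ε hε hε2) < 5
        rw [show cL ε hε hε2 * (rhoB ε hε hε2 - (rhoB ε hε hε2 - delC ε hε hε2 - p1 ε hε hε2 - E1 / cL ε hε hε2) + delC ε hε hε2) =
          2 * (cL ε hε hε2 * delC ε hε hε2) + cL ε hε hε2 * p1 ε hε hε2 + cL ε hε hε2 * (E1 / cL ε hε hε2) by ring, hδ, hp, hEc]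
        linarith
      hθ₀ := by show (0:ℝ) < 1; norm_num
      hθ₀' := by show (1:ℝ) ≤ π / 2; linarith [Real.pi_gt_three]
      hδ := hδ0
      hrh := by show delC ε hε hε2 < rhoB ε hε hε2 - delC ε hε hε2 - p1 ε hε hε2 - E1 / cL ε hε hε2; linarith
      hhc := by show rhoB ε hε hε2 - delC ε hε hε2 - p1 ε hε hε2 - E1 / cL ε hε hε2 + delC ε hε hε2 ≤ rhoB ε hε hε2 + 2 * delC ε hε hε2 - delC ε hε hε2; linarith
      hrc1 := by show rhoB ε hε hε2 + 2 * delC ε hε hε2 ≤ 1; linarith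
      hrcA := by
        show rhoB ε hε hε2 + 2 * delC ε hε hε2 + delC ε hε hε2 ≤ (1 - E1) * bxH * Real.tan (2 * π * (19 / 100))
        have ht := one_lt_tan_face
        rw [bxH]
        have : (1 - E1) * (1 / 5) * 1 ≤ (1 - E1) * (1 / 5) * Real.tan (2 * π * (19 / 100)) :=
          mul_le_mul_of_nonneg_left ht.le (by linarith)
        linarith
      hΛ := by show rhoB ε hε hε2 ≤ rhoB ε hε hε2 + 2 * delC ε hε hε2 - delC ε hε hε2; linarith
      hbox := by show rhoB ε hε hε2 ≤ rhoB ε hε hε2 + 2 * delC ε hε hε2 - delC ε hε hε2; linarith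
      hhandle := by show rhoB ε hε hε2 - delC ε hε hε2 - p1 ε hε hε2 - E1 / cL ε hε hε2 + delC ε hε hε2 + p1 ε hε hε2 + E1 / cL ε hε hε2 ≤ rhoB ε hε hε2; linarith
      hs₁ := ?_
      hs₂ := ?_
      hs₃ := ?_
      hs₄ := ?_
      hs₅ := ?_
      hs₆ := ?_
      hs₇ := ?_
      ha₈ := by show a8 ε < b8 ε; unfold a8 b8; linarith
      hb₈ := ?_
      hμ := fun r hr ↦ ?_
      ldT := fun r hr h1 h2 ↦ ?_ }
  -- the glue radii lie below `c (r_h - δ)`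
  all_goals try (show _ ≤ cL ε hε hε2 * (rhoB ε hε hε2 - delC ε hε hε2 - p1 ε hε hε2 - E1 / cL ε hε hε2 - delC ε hε hε2); rw [hkey])
  · show (3 : ℝ) / 4 ≤ _; linarith
  · show s2 ε ≤ _; linarith
  · show s3 ε ≤ _; unfold s3 s7 rone; have : 0 < 1 / Real.sqrt 3 := by positivity
    linarith
  · show s4 ε ≤ _; unfold s4 s7 rone; linarith
  · show s5 ε ≤ _; unfold s5 s7 rone; have : 0 < 1 / Real.sqrt 3 := by positivity
    linarith
  · show s6 ε ≤ _; unfold s6 s7; have : 0 < 1 / Real.sqrt 3 := by positivity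
    linarith
  · show s7 ε ≤ _; linarith
  · show b8 ε ≤ _; unfold b8; linarith
  · -- `μ_L = 1` beyond `c (r_h - δ) ≥ s₇ + 7/100`
    change cL ε hε hε2 * (rhoB ε hε hε2 - delC ε hε hε2 - p1 ε hε hε2 - E1 / cL ε hε hε2 - delC ε hε hε2) ≤ r at hr
    rw [hkey] at hr
    exact muL_of_ge (by linarith)
  · -- the tube is a local diffeomorphism there
    change ‖r.1‖ < cL ε hε hε2 * (rhoB ε hε hε2 - delC ε hε hε2 - p1 ε hε hε2 - E1 / cL ε hε hε2 + delC ε hε hε2) at hr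
    refine (fishT ε hε hε2).isLocalDiffeomorphAt_tubeD (glueHyp hε hε2) ⟨h1, h2⟩ ?_
    rw [rmaxP]
    calc ‖r.1‖ < _ := hr
      _ ≤ cL ε hε hε2 * (rhoB ε hε hε2 + 2 * delC ε hε hε2) := mul_le_mul_of_nonneg_left (by linarith) hc.le

include hε2 in
/-- The model hypotheses hold for the concrete end data. [folklore] -/
theorem modelHyp : (fishJ ε hε hε2).ModelHyp :=
  (locHyp hε hε2).modelHyp (by show rhoB ε hε hε2 / 4 < 1; linarith [rhoB_le hε hε2])

end FP

end Literature.Topology.FourManifolds
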